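import Summits.BirchSwinnertonDyer.BirchSwinnertonDyer.Theorems.GoldfeldAllTwistsTwoConverseTwinAdditivePrimeTwistSelmer
import HarnessLib

set_option linter.dupNamespace false -- namespace `…BirchSwinnertonDyer.BirchSwinnertonDyer…` is the cell's (D-0017 nested layout)
set_option autoImplicit false

/-!
# Twin″ (item 19140) on the additive prime-twist family, III: the `2`-isogeny Selmer sets of the
# twists `49a1^{(−2ℓ)}`, `ℓ ≡ 1 (mod 4)` prime inert in `ℚ(√−7)` (conductor `3136 ℓ²`, type `I₈*` at `2`)

Cell `bsd-goldfeld`, seat `bsd-goldfeld-s1p-c301` (gen 2); `--supports stmt-BirchSwinnertonDyer-19140`. Third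
file of the prime-twist descent (`…TwinAdditivePrimeTwistSelmer.lean`, `…TwinAdditivePrimeTwistDescent.lean`):
the same complete `2`-isogeny descent for the second additive base curve `B₋₂ = 49a1^{(−2)}` twisted by
`ℓ`, i.e. for `E_{−2ℓ} : y² = x³ − 42ℓ x² + 448ℓ² x` (`= C₀ • cm7.quadraticTwist (−2ℓ)`), where now the
prime `2` divides all coefficients of two of the homogeneous spaces and a `2`-ADIC local lemma is needed:

* `not_isSoluble_two_of_even_coeffs` — at `p = 2`, with `a = 2c`, `d = 2e`, `d' = 2e'`, `e, e'` odd and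
  `e + c + e' ≡ 4 (mod 8)`, the space `w² = d u⁴ + a u²z² + d' z⁴` has no `ℚ₂`-point: in a `ℤ₂`-chart
  `s² = 2(e + ct² + e't⁴)`, so `e + ct² + e't⁴ = 2s₁²`; modulo `8` the left side is odd (`t` even) or
  `e + c + e' = 4` (`t` odd, `t² ≡ 1`), while `2s₁² ∈ {0, 2}` — a finite check in `ℤ/8` (`decide`).
* `mem_of_mem_twoIsogenySelmerGroup_twoPrimeTwist`: **`S(−42ℓ, 448ℓ²) ⊆ {1, 2, 7, 14}`** (real place;
  at `ℓ` the reduced discriminant is `42² − 4·448 = −28 = −7·2²`, a non-residue).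
* `mem_of_mem_twoIsogenySelmerGroup'_twoPrimeTwist`: **`S(84ℓ, −28ℓ²) ⊆ {1, −7}`** (at `ℓ`:
  `84² + 112 = 7168 = 7·32²`, `(7/ℓ) = −1`; at `7`: `−1, −2, −2ℓ², −4ℓ²` are non-residues and
  `7 ∥ 7168ℓ²` — kills `−1, 7, −2, 14`; at `2`: the lemma above kills `2` (`1 + 42ℓ − 7ℓ² ≡ 4`) and
  `−14` (`−7 + 42ℓ + ℓ² ≡ 4 (mod 8)`, as `ℓ ≡ 1 (mod 4)`)).
* The consequences (`rank ≤ 1`; `Ш[2] = 0` in rank one; twin″ ⟺ a `2`-adic unit statement) are drawn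
  in part IV, `…TwinAdditiveTwoPrimeTwistDescent.lean`, exactly as in part II.

Together with parts I–II and IV this settles the algebraic side of twin″ on two of the three additive base
families of `bsdTwoCMSevenAdditiveRankOne_of_baseTwists` restricted to ONE inert prime (`B₋₁^{(ℓ)}`,
`B₋₂^{(ℓ)}`, `ℓ ≡ 1 (mod 4)`); the third (`B₂^{(−ℓ)}`, `ℓ ≡ 3 (mod 4)`) behaves differently at `2`
(numerically `S = {1,7}`, `S' = {1,2,−7,−14}`) and is not treated. HONEST FRAMING: no `BSD(W,2)` is proved.

## References

* J. H. Silverman, *The Arithmetic of Elliptic Curves*, 2nd ed. (2009), Prop. X.4.9, Thm. X.4.2(a).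
  [SilvermanAEC2009]
* D. Zywina, arXiv:2502.01957, Lemma 3.1 (local lemmas reused from `Zywina2025RankTwo.lean`). [Zywina2025]
* R. L. Miller, LMS J. Comput. Math. 14 (2011), Def. 1.1. [Miller2011LMS]
-/

noncomputable section

open scoped Classical

open WeierstrassCurve Literature.NumberTheory.EllipticCurves
open Literature.NumberTheory.EllipticCurves.Zywina2025 (exists_padicInt_of_isSoluble
  isSquare_zmod_of_isSoluble_padic)

namespace Summit.BirchSwinnertonDyer.BirchSwinnertonDyer.Theorems.GoldfeldGoodTwists

/-! ## §1. The `2`-adic local lemma -/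

/-- The finite check behind the `2`-adic lemma: in `ℤ/8`, `(2x+1) + (2 − 2x − 2y)T² + (2y+1)T⁴ ≠ 2S²`.
[folklore] -/
private theorem zmod_eight_key :
    ∀ x y T S : ZMod 8, (2 * x + 1) + (2 - 2 * x - 2 * y) * T ^ 2 + (2 * y + 1) * T ^ 4 ≠ 2 * S ^ 2 := by
  decide

/-- Core: `s² = 2 (g + c t² + g' t⁴)` has no solution in `ℤ₂` when `g, g'` are odd and
`g + c + g' ≡ 4 (mod 8)` (`2 ∣ s`; reduce `g + ct² + g't⁴ = 2 s₁²` modulo `8`). [folklore] -/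
private theorem not_sq_eq_two_mul_quartic {g c g' : ℤ} (hg : Odd g) (hg' : Odd g')
    (h8 : ((g + c + g' : ℤ) : ZMod 8) = 4) {t s : ℤ_[2]}
    (h : s ^ 2 = (2 : ℤ_[2]) * ((g : ℤ_[2]) + (c : ℤ_[2]) * t ^ 2 + (g' : ℤ_[2]) * t ^ 4)) : False := by
  have hpp : Prime (2 : ℤ_[2]) := by simpa using (PadicInt.prime_p (p := 2))
  have h2s : (2 : ℤ_[2]) ∣ s := hpp.dvd_of_dvd_pow (n := 2) ⟨_, h⟩
  obtain ⟨s₁, rfl⟩ := h2s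
  have hg2 : (g : ℤ_[2]) + (c : ℤ_[2]) * t ^ 2 + (g' : ℤ_[2]) * t ^ 4 = 2 * s₁ ^ 2 :=
    (mul_left_cancel₀ hpp.ne_zero (by rw [← h]; ring)).symm
  have hψ := congrArg (PadicInt.toZModPow 3 : ℤ_[2] →+* ZMod (2 ^ 3)) hg2
  simp only [map_add, map_mul, map_pow, map_intCast, map_ofNat] at hψ
  obtain ⟨x, rfl⟩ := hg
  obtain ⟨y, rfl⟩ := hg'
  have hc : ((c : ℤ) : ZMod (2 ^ 3)) = 2 - 2 * (x : ZMod (2 ^ 3)) - 2 * y := by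
    have h8' : (((2 * x + 1) + c + (2 * y + 1) : ℤ) : ZMod (2 ^ 3)) = 4 := h8
    push_cast at h8'
    linear_combination h8'
  push_cast at hψ
  rw [hc] at hψ
  exact zmod_eight_key (x : ZMod (2 ^ 3)) y (PadicInt.toZModPow 3 t) (PadicInt.toZModPow 3 s₁) hψ

/-- **`2`-adic local lemma.** If `a = 2c`, `d = 2e`, `d' = 2e'` with `e, e'` odd and
`e + c + e' ≡ 4 (mod 8)`, then `w² = d u⁴ + a u²z² + d' z⁴` has no non-trivial `ℚ₂`-point (both
`ℤ₂`-charts of `exists_padicInt_of_isSoluble` are instances of `not_sq_eq_two_mul_quartic`).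
[cite: SilvermanAEC2009, Prop. X.4.9 and Example X.4.10] -/
theorem not_isSoluble_two_of_even_coeffs {a d d' c e e' : ℤ} (ha : a = 2 * c) (hd : d = 2 * e)
    (hd' : d' = 2 * e') (he : Odd e) (he' : Odd e') (h8 : ((e + c + e' : ℤ) : ZMod 8) = 4) :
    ¬ ((twoIsogenyQuartic a d d').map (Int.castRingHom ℚ_[2])).IsSoluble := by
  haveI : Fact (Nat.Prime 2) := ⟨Nat.prime_two⟩
  intro h
  obtain ⟨f, f', hff, t, s, hs⟩ := exists_padicInt_of_isSoluble h
  rcases hff with ⟨rfl, rfl⟩ | ⟨rfl, rfl⟩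
  · exact not_sq_eq_two_mul_quartic (c := c) he he' h8 (t := t) (s := s)
      (by rw [hs, ha, hd, hd']; push_cast; ring)
  · have h8' : ((e' + c + e : ℤ) : ZMod 8) = 4 := by rw [← h8]; push_cast; ring
    exact not_sq_eq_two_mul_quartic (c := c) he' he h8' (t := t) (s := s)
      (by rw [hs, ha, hd, hd']; push_cast; ring)

/-! ## §2. Number-theoretic inputs -/

/-- A non-square stays a non-square after multiplication by a nonzero square (in `ℤ/ℓ`, `ℓ` prime).
[folklore] -/
private theorem not_isSquare_mul_sq {l : ℕ} [Fact l.Prime] {a k : ℤ} (hk : ((k : ℤ) : ZMod l) ≠ 0)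
    (ha : ¬ IsSquare ((a : ℤ) : ZMod l)) : ¬ IsSquare (((a * k ^ 2 : ℤ)) : ZMod l) := by
  rintro ⟨r, hr⟩
  apply ha
  refine ⟨r * ((k : ℤ) : ZMod l)⁻¹, ?_⟩
  push_cast at hr hk ⊢
  calc (a : ZMod l) = a * ((k : ZMod l) * (k : ZMod l)⁻¹) ^ 2 := by rw [mul_inv_cancel₀ hk]; ring
    _ = a * (k : ZMod l) ^ 2 * ((k : ZMod l)⁻¹) ^ 2 := by ring
    _ = r * r * ((k : ZMod l)⁻¹) ^ 2 := by rw [hr]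
    _ = r * (k : ZMod l)⁻¹ * (r * (k : ZMod l)⁻¹) := by ring

/-- `(−7/ℓ) = −1`, `ℓ ≡ 1 (mod 4)` ⇒ `(7/ℓ) = −1`. [folklore] -/
private theorem legendreSym_seven {l : ℕ} [Fact l.Prime] (hl4 : l % 4 = 1)
    (hl7 : legendreSym l (-7) = -1) : legendreSym l 7 = -1 := by
  have hl2 : l ≠ 2 := by rintro rfl; norm_num at hl4
  have h1 : legendreSym l (-1) = 1 := by
    rw [legendreSym.at_neg_one hl2, ZMod.χ₄_nat_one_mod_four hl4]
  have hmul : legendreSym l (-7) = legendreSym l (-1) * legendreSym l 7 := by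
    rw [← legendreSym.mul]; norm_num
  rwa [hmul, h1, one_mul] at hl7

/-- `ℓ ≠ 7` when `(−7/ℓ) = −1`. [folklore] -/
private theorem ne_seven {l : ℕ} [Fact l.Prime] (hl7 : legendreSym l (-7) = -1) : l ≠ 7 := by
  rintro rfl
  have h0 : legendreSym 7 (-7) = 0 :=
    (legendreSym.eq_zero_iff 7 (-7)).mpr ((ZMod.intCast_zmod_eq_zero_iff_dvd (-7) 7).mpr ⟨-1, by norm_num⟩)
  rw [h0] at hl7
  norm_num at hl7

/-- A divisor of a power of `2` is nonzero modulo an odd prime. [folklore] -/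
private theorem natCast_ne_zero_of_dvd_two_pow {l : ℕ} [Fact l.Prime] (hl2 : l ≠ 2) {k n : ℕ}
    (hk : k ∣ 2 ^ n) : ((k : ℤ) : ZMod l) ≠ 0 := by
  intro h
  have h2 : ((k : ℕ) : ZMod l) = 0 := by exact_mod_cast h
  rw [ZMod.natCast_eq_zero_iff] at h2
  exact hl2 ((Nat.prime_dvd_prime_iff_eq Fact.out Nat.prime_two).mp
    ((Fact.out : l.Prime).dvd_of_dvd_pow (h2.trans hk)))

/-- `7 ∥ 7168 ℓ²` for a prime `ℓ ≠ 7` (`7168 = 7 · 1024`). [folklore] -/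
private theorem not_sq_seven_dvd' {l : ℕ} (hl : l.Prime) (hl7 : l ≠ 7) :
    ¬ ((7 : ℤ) ^ 2 ∣ 7168 * (l : ℤ) ^ 2) := by
  intro h
  have h7p : Prime (7 : ℤ) := Int.prime_iff_natAbs_prime.mpr (by norm_num)
  have h1 : (7 : ℤ) ∣ 1024 * (l : ℤ) ^ 2 := by
    have h' : (7 : ℤ) * 7 ∣ 7 * (1024 * (l : ℤ) ^ 2) := by
      rw [← pow_two, show (7 : ℤ) * (1024 * (l : ℤ) ^ 2) = 7168 * (l : ℤ) ^ 2 by ring]; exact h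
    exact (mul_dvd_mul_iff_left (by norm_num : (7 : ℤ) ≠ 0)).mp h'
  rcases h7p.dvd_or_dvd h1 with h2 | h2
  · norm_num at h2
  · have h3 : (7 : ℤ) ∣ (l : ℤ) := h7p.dvd_of_dvd_pow h2
    have h4 : (7 : ℕ) ∣ l := by exact_mod_cast h3
    exact hl7 ((Nat.prime_dvd_prime_iff_eq (by norm_num) hl).mp h4).symm

/-- `ℓ ≡ 1 (mod 4)` ⇒ `ℓ ≡ 1` or `5 (mod 8)`, in `ℤ/8`. [folklore] -/
private theorem zmod_eight_of_mod_four {l : ℕ} (hl4 : l % 4 = 1) :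
    (l : ZMod 8) = 1 ∨ (l : ZMod 8) = 5 := by
  have h : l % 8 = 1 ∨ l % 8 = 5 := by omega
  rcases h with h | h
  · left; rw [← ZMod.natCast_mod l 8, h]; norm_num
  · right; rw [← ZMod.natCast_mod l 8, h]; norm_num

/-- The two residue computations mod `8` used at the prime `2` (`x = ℓ mod 8 ∈ {1, 5}`). [folklore] -/
private theorem zmod_eight_sums : ∀ x : ZMod 8, x = 1 ∨ x = 5 →
    (1 + 42 * x + -7 * x ^ 2 = 4 ∧ -7 + 42 * x + x ^ 2 = 4) := by
  decide

/-- Non-residues mod `7` used at the prime `7`: `−1`, `−2`, `−4x²`, `−2x²` (`x ≠ 0`). [folklore] -/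
private theorem zmod_seven_nonresidues :
    (∀ r : ZMod 7, r * r ≠ -1) ∧ (∀ r : ZMod 7, r * r ≠ -2) ∧
      (∀ x r : ZMod 7, x ≠ 0 → r * r ≠ -4 * x ^ 2) ∧ (∀ x r : ZMod 7, x ≠ 0 → r * r ≠ -2 * x ^ 2) := by
  refine ⟨by decide, by decide, by decide, by decide⟩

/-! ## §3. The Selmer sets of `E_{−2ℓ} : y² = x³ − 42ℓ x² + 448ℓ² x` -/

/-- **`S(−42ℓ, 448ℓ²) ⊆ {1, 2, 7, 14}`** (descent on the divisors of `b`; Silverman X.4.9) for a prime `ℓ`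
with `(−7/ℓ) = −1`: the real place kills `d < 0`; at `ℓ` a class divisible by `ℓ` has reduced
discriminant `42² − 4·448 = −28 = −7·2²`, a non-residue. [cite: SilvermanAEC2009, Prop. X.4.9 and Example X.4.10] -/
theorem mem_of_mem_twoIsogenySelmerGroup_twoPrimeTwist {l : ℕ} [Fact l.Prime] (hl4 : l % 4 = 1)
    (hl7 : legendreSym l (-7) = -1) {d : ℤ}
    (hd : d ∈ twoIsogenySelmerGroup (-42 * l) (448 * l ^ 2)) :
    d ∈ ({1, 2, 7, 14} : Finset ℤ) := by
  have hl : l.Prime := Fact.out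
  have hlp : Prime (l : ℤ) := Nat.prime_iff_prime_int.mp hl
  have hl0 : (l : ℤ) ≠ 0 := by exact_mod_cast hl.ne_zero
  have hl2 : l ≠ 2 := by rintro rfl; norm_num at hl4
  have hb : (448 * l ^ 2 : ℤ) ≠ 0 := by positivity
  rw [mem_twoIsogenySelmerGroup_iff hb] at hd
  obtain ⟨hsqf, ⟨d', hdd'⟩, hloc⟩ := hd
  have hd'eq : (448 * l ^ 2 : ℤ) / d = d' := by
    rw [hdd', Int.mul_ediv_cancel_left _ hsqf.ne_zero]
  rw [hd'eq] at hloc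
  obtain ⟨hreal, hpadic⟩ := hloc
  have hdpos : 0 < d := by
    rcases lt_or_gt_of_ne hsqf.ne_zero with hneg | hpos
    · exfalso
      have hbpos : (0 : ℤ) < 448 * (l : ℤ) ^ 2 := by positivity
      have hd'neg : d' < 0 := by
        by_contra hcon
        nlinarith [mul_nonpos_iff.mpr (Or.inr ⟨hneg.le, le_of_not_gt hcon⟩)]
      have ha : (-42 * (l : ℤ)) ≤ 0 := by
        have : (0 : ℤ) ≤ l := by positivity
        linarith
      exact not_isSoluble_real_twoIsogenyQuartic_of_neg hneg hd'neg ha hreal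
    · exact hpos
  have hld : ¬ (l : ℤ) ∣ d := by
    rintro ⟨e, rfl⟩
    have h1 : e * d' = 448 * l := mul_left_cancel₀ hl0 (by linear_combination (-1 : ℤ) * hdd')
    have h2 : (l : ℤ) ∣ e * d' := ⟨448, by rw [h1]; ring⟩
    rcases hlp.dvd_or_dvd h2 with h3 | h3
    · obtain ⟨e₁, rfl⟩ := h3
      exact hlp.not_unit (hsqf (l : ℤ) ⟨e₁, by ring⟩)
    · obtain ⟨e', rfl⟩ := h3
      have hm : e * e' = 448 := mul_left_cancel₀ hl0 (by linear_combination h1)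
      have hns : ¬ IsSquare ((((-42) ^ 2 - 4 * 448 : ℤ)) : ZMod l) := by
        rw [show ((-42 : ℤ) ^ 2 - 4 * 448 : ℤ) = -7 * (2 : ℕ) ^ 2 by norm_num]
        exact not_isSquare_mul_sq (natCast_ne_zero_of_dvd_two_pow hl2 (n := 1) (by norm_num))
          ((legendreSym.eq_neg_one_iff l).mp hl7)
      exact not_isSoluble_padic_of_prime_dvd_coeffs (p := l) (c := -42) (by ring) rfl rfl hm hns
        (hpadic l)
  have h14 : d ∣ 14 := by
    have h0 : d ∣ 448 * (l : ℤ) ^ 2 := ⟨d', hdd'⟩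
    have h1 : d ∣ (14 * (l : ℤ)) ^ 6 := h0.trans ⟨16807 * (l : ℤ) ^ 4, by ring⟩
    have h2 : d ∣ 14 * (l : ℤ) := (hsqf.dvd_pow_iff_dvd (by norm_num)).mp h1
    have hcop : IsCoprime d (l : ℤ) := ((hlp.irreducible.coprime_iff_not_dvd).mpr hld).symm
    exact hcop.dvd_of_dvd_mul_right h2
  have hle : d ≤ 14 := Int.le_of_dvd (by norm_num) h14
  interval_cases d <;> first | (exfalso; omega) | simp

/-- **`S'(−42ℓ, 448ℓ²) = S(84ℓ, −28ℓ²) ⊆ {1, −7}`** (descent on the divisors of `a² − 4b = −28ℓ²`;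
Silverman X.4.9) for a prime `ℓ ≡ 1 (mod 4)` with `(−7/ℓ) = −1`: at `ℓ` (`84² + 112 = 7168 = 7·32²`,
`(7/ℓ) = −1`) the classes divisible by `ℓ` die; so `d ∣ 14`; at `7` (`7 ∥ 7168ℓ²`; `−1`, `−2`, `−2ℓ²`,
`−4ℓ²` non-residues) the classes `−1, −2, 14, 7` die; at `2` (`not_isSoluble_two_of_even_coeffs`) the
classes `2` and `−14` die. [cite: SilvermanAEC2009, Prop. X.4.9] [cite: Zywina2025, Lemma 3.1 (proof)] -/
theorem mem_of_mem_twoIsogenySelmerGroup'_twoPrimeTwist {l : ℕ} [Fact l.Prime] (hl4 : l % 4 = 1)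
    (hl7 : legendreSym l (-7) = -1) {d : ℤ}
    (hd : d ∈ twoIsogenySelmerGroup' (-42 * l) (448 * l ^ 2)) :
    d ∈ ({1, -7} : Finset ℤ) := by
  have hl : l.Prime := Fact.out
  haveI : Fact (Nat.Prime 7) := ⟨by norm_num⟩
  have hlp : Prime (l : ℤ) := Nat.prime_iff_prime_int.mp hl
  have hl0 : (l : ℤ) ≠ 0 := by exact_mod_cast hl.ne_zero
  have hl2 : l ≠ 2 := by rintro rfl; norm_num at hl4
  have hl7' : l ≠ 7 := ne_seven hl7
  have hlodd : Odd (l : ℤ) := Int.odd_iff.mpr (by omega)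
  have hA : (-2 * (-42 * l : ℤ)) = 84 * l := by ring
  have hB : ((-42 * l : ℤ) ^ 2 - 4 * (448 * l ^ 2)) = -28 * l ^ 2 := by ring
  rw [twoIsogenySelmerGroup'_eq, hA, hB] at hd
  have hb : (-28 * l ^ 2 : ℤ) ≠ 0 := mul_ne_zero (by norm_num) (pow_ne_zero 2 hl0)
  rw [mem_twoIsogenySelmerGroup_iff hb] at hd
  obtain ⟨hsqf, ⟨d', hdd'⟩, hloc⟩ := hd
  have hd'eq : (-28 * l ^ 2 : ℤ) / d = d' := by
    rw [hdd', Int.mul_ediv_cancel_left _ hsqf.ne_zero]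
  rw [hd'eq] at hloc
  obtain ⟨-, hpadic⟩ := hloc
  -- the place `ℓ`
  have hld : ¬ (l : ℤ) ∣ d := by
    rintro ⟨e, rfl⟩
    have h1 : e * d' = -28 * l := mul_left_cancel₀ hl0 (by linear_combination (-1 : ℤ) * hdd')
    have h2 : (l : ℤ) ∣ e * d' := ⟨-28, by rw [h1]; ring⟩
    rcases hlp.dvd_or_dvd h2 with h3 | h3
    · obtain ⟨e₁, rfl⟩ := h3
      exact hlp.not_unit (hsqf (l : ℤ) ⟨e₁, by ring⟩)
    · obtain ⟨e', rfl⟩ := h3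
      have hm : e * e' = -28 := mul_left_cancel₀ hl0 (by linear_combination h1)
      have hns : ¬ IsSquare ((((84 : ℤ)) ^ 2 - 4 * (-28) : ℤ) : ZMod l) := by
        rw [show ((84 : ℤ) ^ 2 - 4 * (-28) : ℤ) = 7 * (32 : ℕ) ^ 2 by norm_num]
        exact not_isSquare_mul_sq (natCast_ne_zero_of_dvd_two_pow hl2 (n := 5) (by norm_num))
          ((legendreSym.eq_neg_one_iff l).mp (legendreSym_seven hl4 hl7))
      exact not_isSoluble_padic_of_prime_dvd_coeffs (p := l) (c := 84) (by ring) rfl rfl hm hns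
        (hpadic l)
  -- so `d ∣ 14`
  have h14 : d ∣ 14 := by
    have h0 : d ∣ -28 * (l : ℤ) ^ 2 := ⟨d', hdd'⟩
    have h1 : d ∣ (14 * (l : ℤ)) ^ 2 := h0.trans ⟨-7, by ring⟩
    have h2 : d ∣ 14 * (l : ℤ) := (hsqf.dvd_pow_iff_dvd (by norm_num)).mp h1
    have hcop : IsCoprime d (l : ℤ) := ((hlp.irreducible.coprime_iff_not_dvd).mpr hld).symm
    exact hcop.dvd_of_dvd_mul_right h2
  have hle : d ≤ 14 := Int.le_of_dvd (by norm_num) h14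
  have hge : -14 ≤ d := by
    have := Int.le_of_dvd (by norm_num) ((Int.neg_dvd).mpr h14)
    linarith
  -- the discriminant at `7`
  have hdisc7 : ∀ x y : ℤ, x * y = -28 * (l : ℤ) ^ 2 →
      (7 : ℤ) ∣ (84 * (l : ℤ)) ^ 2 - 4 * x * y ∧ ¬ (7 : ℤ) ^ 2 ∣ (84 * (l : ℤ)) ^ 2 - 4 * x * y := by
    intro x y hxy
    have e1 : (84 * (l : ℤ)) ^ 2 - 4 * x * y = 7168 * (l : ℤ) ^ 2 := by
      rw [mul_assoc, hxy]; ring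
    rw [e1]
    exact ⟨⟨1024 * (l : ℤ) ^ 2, by ring⟩, not_sq_seven_dvd' hl hl7'⟩
  have hl07 : ((l : ℤ) : ZMod 7) ≠ 0 := by
    rw [Ne, ZMod.intCast_zmod_eq_zero_iff_dvd]
    intro h3
    have h4 : (7 : ℕ) ∣ l := by exact_mod_cast h3
    exact hl7' ((Nat.prime_dvd_prime_iff_eq (by norm_num) hl).mp h4).symm
  -- `d = -1`: `-1` would be a square mod 7
  have hm1 : d ≠ -1 := by
    rintro rfl
    obtain ⟨hB1, hB2⟩ := hdisc7 (-1) d' hdd'.symm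
    obtain ⟨-, r, hr⟩ := isSquare_zmod_of_isSoluble_padic (p := 7) (by norm_num) (by decide) hB1 hB2
      (hpadic 7)
    push_cast at hr
    exact zmod_seven_nonresidues.1 r hr.symm
  -- `d = -2`: `-2` would be a square mod 7
  have hm2 : d ≠ -2 := by
    rintro rfl
    obtain ⟨hB1, hB2⟩ := hdisc7 (-2) d' hdd'.symm
    obtain ⟨-, r, hr⟩ := isSquare_zmod_of_isSoluble_padic (p := 7) (by norm_num) (by decide) hB1 hB2
      (hpadic 7)
    push_cast at hr
    exact zmod_seven_nonresidues.2.1 r hr.symm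
  -- `d = 7`: `d' = -4ℓ²` would be a square mod 7
  have hp7 : d ≠ 7 := by
    rintro rfl
    have hd'1 : d' = -4 * (l : ℤ) ^ 2 := by linarith
    subst hd'1
    have hsol := (isSoluble_map_twoIsogenyQuartic_comm (Int.castRingHom ℚ_[7]) (84 * (l : ℤ)) 7
      (-4 * (l : ℤ) ^ 2)).mp (hpadic 7)
    have hnd : ¬ (7 : ℤ) ∣ -4 * (l : ℤ) ^ 2 := by
      intro h
      have h7p : Prime (7 : ℤ) := Int.prime_iff_natAbs_prime.mpr (by norm_num)
      rcases h7p.dvd_or_dvd h with h5 | h5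
      · norm_num at h5
      · exact hl07 ((ZMod.intCast_zmod_eq_zero_iff_dvd _ 7).mpr (h7p.dvd_of_dvd_pow h5))
    obtain ⟨hB1, hB2⟩ := hdisc7 (-4 * (l : ℤ) ^ 2) 7 (by ring)
    obtain ⟨-, r, hr⟩ := isSquare_zmod_of_isSoluble_padic (p := 7) (by norm_num) hnd hB1 hB2 hsol
    push_cast at hr
    exact zmod_seven_nonresidues.2.2.1 _ r (by exact_mod_cast hl07) hr.symm
  -- `d = 14`: `d' = -2ℓ²` would be a square mod 7
  have hp14 : d ≠ 14 := by
    rintro rfl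
    have hd'1 : d' = -2 * (l : ℤ) ^ 2 := by linarith
    subst hd'1
    have hsol := (isSoluble_map_twoIsogenyQuartic_comm (Int.castRingHom ℚ_[7]) (84 * (l : ℤ)) 14
      (-2 * (l : ℤ) ^ 2)).mp (hpadic 7)
    have hnd : ¬ (7 : ℤ) ∣ -2 * (l : ℤ) ^ 2 := by
      intro h
      have h7p : Prime (7 : ℤ) := Int.prime_iff_natAbs_prime.mpr (by norm_num)
      rcases h7p.dvd_or_dvd h with h5 | h5
      · norm_num at h5
      · exact hl07 ((ZMod.intCast_zmod_eq_zero_iff_dvd _ 7).mpr (h7p.dvd_of_dvd_pow h5))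
    obtain ⟨hB1, hB2⟩ := hdisc7 (-2 * (l : ℤ) ^ 2) 14 (by ring)
    obtain ⟨-, r, hr⟩ := isSquare_zmod_of_isSoluble_padic (p := 7) (by norm_num) hnd hB1 hB2 hsol
    push_cast at hr
    exact zmod_seven_nonresidues.2.2.2 _ r (by exact_mod_cast hl07) hr.symm
  -- `d = 2` and `d = -14`: no `ℚ₂`-point
  have h8cases := zmod_eight_of_mod_four hl4
  have hp2 : d ≠ 2 := by
    rintro rfl
    have hd'1 : d' = -14 * (l : ℤ) ^ 2 := by linarith
    subst hd'1
    have hodd' : Odd (-7 * (l : ℤ) ^ 2) := (by decide : Odd (-7 : ℤ)).mul hlodd.pow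
    have h8 : ((1 + 42 * (l : ℤ) + -7 * (l : ℤ) ^ 2 : ℤ) : ZMod 8) = 4 := by
      push_cast
      exact (zmod_eight_sums (l : ZMod 8) h8cases).1
    exact not_isSoluble_two_of_even_coeffs (a := 84 * (l : ℤ)) (c := 42 * (l : ℤ)) (e := 1)
      (e' := -7 * (l : ℤ) ^ 2) (by ring) (by ring) (by ring) odd_one hodd' h8 (hpadic 2)
  have hm14 : d ≠ -14 := by
    rintro rfl
    have hd'1 : d' = 2 * (l : ℤ) ^ 2 := by linarith
    subst hd'1
    have h8 : ((-7 + 42 * (l : ℤ) + (l : ℤ) ^ 2 : ℤ) : ZMod 8) = 4 := by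
      push_cast
      exact (zmod_eight_sums (l : ZMod 8) h8cases).2
    exact not_isSoluble_two_of_even_coeffs (a := 84 * (l : ℤ)) (c := 42 * (l : ℤ)) (e := -7)
      (e' := (l : ℤ) ^ 2) (by ring) (by ring) (by ring) (by decide) hlodd.pow h8 (hpadic 2)
  obtain ⟨k, hk⟩ := h14
  interval_cases d <;> first | (exfalso; omega) | simp


end Summit.BirchSwinnertonDyer.BirchSwinnertonDyer.Theorems.GoldfeldGoodTwists

end
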